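import Summits.CriticalPhenomena.PercolationContinuityZ3.Theorems.PercNearOneGluingNoHeavyLowerTailThreePartitionGridTransport
import Summits.CriticalPhenomena.PercolationContinuityZ3.Theorems.PercNearOneGluingNoHeavyLowerTailThreePartitionCensored
import HarnessLib.Audit

/-!
# `NoHeavyLowerTail` (crux stmt-CriticalPhenomena-4575), master-family hierarchy P3 (gen 34): the grid-transport conjecture
# `GridTransport` HOLDS FOR NESTED PAIRS (`𝒱 ⊆ 𝒲` or `𝒲 ⊆ 𝒱`) — by two fibrewise Kleitman moves each

Support file (seat `prim-masterthm-p3`; `--supports stmt-CriticalPhenomena-4575`; memo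
`run/shared/lean/prim/prim-masterthm/FROM-prim-masterthm-p3-g34-FIBRE-LOCAL-CERTIFICATE.md` §1, HIERARCHY §41).  Companion of
`…ThreePartitionGridTransport` (`gtKernel`, conjecture `GridTransport`) and of `…ThreePartitionVOrderNested` (the same face of bnk-2's Conjecture V).

For up-sets `𝒱, 𝒲`, a twist `τ` and a family `𝒰` of configurations closed upwards in the grid order (copy 1 grows, copy 2 shrinks) write
`T(p) = #{(x₁,x₂,x₃) ∈ 𝒰 : p}` (a twisted three-partition count).  The kernel sum is
  `∑_{q∈𝒰} κ(q) = 2T(x₁∈𝒱𝒲) + T(x₂∈𝒱, x₃∈𝒲) − T(x₁∈𝒱, x₃∈𝒲) − T(x₁∈𝒲, x₂∈𝒱) − T(x₂∈𝒱𝒲)`   (`sum_gtKernel_filter_eq`),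
and (this work, memo §1(a))
* `𝒱 ⊆ 𝒲`:  `∑ = [T(x₁∈𝒱) − T(x₂∈𝒱, x₁∈𝒲)] + [T(x₁∈𝒱, x₃∉𝒲) − T(x₂∈𝒱, x₃∉𝒲)]`,
* `𝒲 ⊆ 𝒱`:  `∑ = [T(x₁∈𝒲) − T(x₂∈𝒲)] + [T(x₁∈𝒲, x₂∉𝒱) − T(x₃∈𝒲, x₁∈𝒱, x₂∉𝒱)] + T(x₃∈𝒲, x₂∈𝒱, x₁∉𝒱)`,
every bracket being `≥ 0` by ONE fibrewise Kleitman move of `…ThreePartitionVOrderNested` (`triT_col_le`: on a fibre with copy 2 resp. copy 3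
fixed, an increasing requirement moves from copy 3 resp. copy 2 to copy 1; the section of `𝒰` is an up-set of the fibre cube).  Hence
**`∑_{q∈𝒰} κ_{τ,𝒱,𝒲}(q) ≥ 0` whenever `𝒱 ⊆ 𝒲` or `𝒲 ⊆ 𝒱`** (`sum_gtKernel_nonneg_of_subset`, `sum_gtKernel_nonneg_of_supset`,
`sum_gtKernel_nonneg_of_nested`): the nested face of `GridTransport`.  The general case reduces (memo §1) to 'terminal' pairs and is OPEN.
HONEST LABEL: a face of an open conjecture; nothing here bears on the crux. [this work]
-/

noncomputable section

open Finset
open scoped symmDiff Classical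

namespace Summit.CriticalPhenomena.PercolationContinuityZ3.Theorems.ThreePartition

variable {ι : Type*} [Fintype ι]

/-! ## Counting over a family of configurations -/

/-- The membership predicate of a family of configurations (pairs of parts), read on the copies. [this work] -/
def inU (τ : Set ι) (𝒰 : Set (Set ι × Set ι)) (a b : Set ι) : Prop := (a ∆ τ, b ∆ τ) ∈ 𝒰

omit [Fintype ι] in
/-- On configurations, `inU` is membership. [this work] -/
theorem inU_cp (τ : Set ι) (𝒰 : Set (Set ι × Set ι)) (q : Set ι × Set ι) :
    inU τ 𝒰 (cp₁ τ q) (cp₂ τ q) ↔ q ∈ 𝒰 := by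
  unfold inU cp₁ cp₂
  rw [symmDiff_symmDiff_cancel_right, symmDiff_symmDiff_cancel_right]

/-- **The kernel sum over a family as five twisted counts.** [this work] -/
theorem sum_gtKernel_filter_eq (τ : Set ι) (𝒱 𝒲 : Set (Set ι)) (𝒰 : Set (Set ι × Set ι)) :
    ∑ q ∈ (cfgs ι).filter (fun q => q ∈ 𝒰), gtKernel τ 𝒱 𝒲 q
      = 2 * (triT τ (fun a b _ => inU τ 𝒰 a b ∧ a ∈ 𝒱 ∩ 𝒲) : ℤ)
        + triT τ (fun a b c => inU τ 𝒰 a b ∧ (b ∈ 𝒱 ∧ c ∈ 𝒲))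
        - triT τ (fun a b c => inU τ 𝒰 a b ∧ (a ∈ 𝒱 ∧ c ∈ 𝒲))
        - triT τ (fun a b _ => inU τ 𝒰 a b ∧ (a ∈ 𝒲 ∧ b ∈ 𝒱))
        - triT τ (fun a b _ => inU τ 𝒰 a b ∧ b ∈ 𝒱 ∩ 𝒲) := by
  simp only [triT_eq_card_cfgs, inU_cp]
  rw [sum_filter]
  have e : ∀ q, (if q ∈ 𝒰 then gtKernel τ 𝒱 𝒲 q else 0)
      = 2 * (if q ∈ 𝒰 ∧ cp₁ τ q ∈ 𝒱 ∩ 𝒲 then (1 : ℤ) else 0)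
        + (if q ∈ 𝒰 ∧ (cp₂ τ q ∈ 𝒱 ∧ cp₃ τ q ∈ 𝒲) then (1 : ℤ) else 0)
        - (if q ∈ 𝒰 ∧ (cp₁ τ q ∈ 𝒱 ∧ cp₃ τ q ∈ 𝒲) then (1 : ℤ) else 0)
        - (if q ∈ 𝒰 ∧ (cp₁ τ q ∈ 𝒲 ∧ cp₂ τ q ∈ 𝒱) then (1 : ℤ) else 0)
        - (if q ∈ 𝒰 ∧ cp₂ τ q ∈ 𝒱 ∩ 𝒲 then (1 : ℤ) else 0) := by
    intro q
    unfold gtKernel ind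
    by_cases u : q ∈ 𝒰 <;> by_cases a : cp₁ τ q ∈ 𝒱 <;> by_cases b : cp₁ τ q ∈ 𝒲 <;> by_cases c : cp₂ τ q ∈ 𝒱 <;>
      by_cases d : cp₂ τ q ∈ 𝒲 <;> by_cases f : cp₃ τ q ∈ 𝒲 <;> simp [u, a, b, c, d, f, Set.mem_inter_iff]
  rw [Finset.sum_congr rfl fun q _ => e q]
  simp only [Finset.sum_sub_distrib, Finset.sum_add_distrib, ← Finset.mul_sum, natCast_card_filter]

/-! ## Sections of a grid-up-set are up-sets of the fibre cubes -/

section Fibres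

variable {τ : Set ι} {𝒰 : Set (Set ι × Set ι)}
  (h𝒰 : ∀ q q' : Set ι × Set ι, q ∈ 𝒰 → q.1 ∆ τ ⊆ q'.1 ∆ τ → q'.2 ∆ τ ⊆ q.2 ∆ τ → q' ∈ 𝒰)
include h𝒰

omit [Fintype ι] in
/-- With copy 2 fixed, the section of `𝒰` in copy 1 is an up-set. [this work] -/
theorem isUpperSet_inU_snd (b : Set ι) : IsUpperSet {a : Set ι | inU τ 𝒰 a b} := by
  intro a a' hle ha
  simp only [Set.mem_setOf_eq, inU] at ha ⊢
  refine h𝒰 (a ∆ τ, b ∆ τ) (a' ∆ τ, b ∆ τ) ha ?_ ?_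
  · simp only [symmDiff_symmDiff_cancel_right]; exact hle
  · exact subset_rfl

omit [Fintype ι] in
/-- With copy 3 fixed (`c`), the section of `𝒰` in copy 1 is an up-set: copy 2 is then `((a ∆ τ) ∪ (c ∆ τ))ᶜ ∆ τ`, which shrinks as
`a` grows. [this work] -/
theorem isUpperSet_inU_thd (c : Set ι) :
    IsUpperSet {a : Set ι | inU τ 𝒰 a ((((a ∆ τ) ∪ (c ∆ τ))ᶜ) ∆ τ)} := by
  intro a a' hle ha
  simp only [Set.mem_setOf_eq, inU, symmDiff_symmDiff_cancel_right] at ha ⊢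
  refine h𝒰 _ _ ha ?_ ?_
  · simp only [symmDiff_symmDiff_cancel_right]; exact hle
  · -- `(((a' ∆ τ) ∪ (c ∆ τ))ᶜ) ∆ τ ⊆ (((a ∆ τ) ∪ (c ∆ τ))ᶜ) ∆ τ`
    intro i hi
    simp only [Set.mem_symmDiff, Set.mem_compl_iff, Set.mem_union] at hi ⊢
    have hle' : i ∈ a → i ∈ a' := fun h => hle h
    tauto

end Fibres

/-! ## The two fibrewise moves, with the family `𝒰` as context -/

/-- **x₃-fibre Kleitman**: with copy 3 fixed, an increasing requirement moves from copy 2 to copy 1: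
`T(𝒰, R(x₁,x₃), x₂ ∈ G) ≤ T(𝒰, R(x₁,x₃), x₁ ∈ G)` for any extra requirement `R` increasing in `x₁`. [this work] -/
theorem triT_move23_le (τ : Set ι) {𝒰 : Set (Set ι × Set ι)}
    (h𝒰 : ∀ q q' : Set ι × Set ι, q ∈ 𝒰 → q.1 ∆ τ ⊆ q'.1 ∆ τ → q'.2 ∆ τ ⊆ q.2 ∆ τ → q' ∈ 𝒰)
    (R : Set ι → Set ι → Prop) (hR : ∀ c, IsUpperSet {a : Set ι | R a c}) {G : Set (Set ι)} (hG : IsUpperSet G) :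
    triT τ (fun a b c => (inU τ 𝒰 a b ∧ R a c) ∧ b ∈ G) ≤ triT τ (fun a b c => (inU τ 𝒰 a b ∧ R a c) ∧ a ∈ G) := by
  -- on a genuine configuration copy 2 is determined by copies 1 and 3
  have key : ∀ p : Set ι → Set ι → Set ι → Prop,
      triT τ (fun a b c => (inU τ 𝒰 a b ∧ R a c) ∧ p a b c)
        = triT τ (fun a b c => (inU τ 𝒰 a ((((a ∆ τ) ∪ (c ∆ τ))ᶜ) ∆ τ) ∧ R a c) ∧ p a b c) := by
    intro p
    rw [triT_eq_card_cfgs, triT_eq_card_cfgs]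
    congr 1
    ext q
    simp only [mem_filter, and_congr_right_iff]
    intro hq
    simp only [cfgs, mem_filter, mem_univ, true_and] at hq
    have e : (((cp₁ τ q ∆ τ) ∪ (cp₃ τ q ∆ τ))ᶜ) ∆ τ = cp₂ τ q := by
      unfold cp₁ cp₂ cp₃
      rw [symmDiff_symmDiff_cancel_right, symmDiff_symmDiff_cancel_right, compl_union_compl_eq_snd hq]
    rw [e]
  rw [key (fun _ b _ => b ∈ G), key (fun a _ _ => a ∈ G), triT_swap23 τ, triT_swap23 τ (fun a b c => _ ∧ a ∈ G)]
  have hA : ∀ b : Set ι, IsUpperSet {a : Set ι | inU τ 𝒰 a ((((a ∆ τ) ∪ (b ∆ τ))ᶜ) ∆ τ) ∧ R a b} :=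
    fun b => (isUpperSet_inU_thd h𝒰 b).inter (hR b)
  have h := triT_col_le τ (fun b => {a : Set ι | inU τ 𝒰 a ((((a ∆ τ) ∪ (b ∆ τ))ᶜ) ∆ τ) ∧ R a b}) hA hG
  refine le_trans (le_of_eq (triT_congr fun a b c => ?_)) (le_trans h (le_of_eq (triT_congr fun a b c => ?_)))
  · simp only [Set.mem_setOf_eq]
  · simp only [Set.mem_setOf_eq]

/-- **x₂-fibre Kleitman**: with copy 2 fixed, an increasing requirement moves from copy 3 to copy 1:
`T(𝒰, R(x₁,x₂), x₃ ∈ G) ≤ T(𝒰, R(x₁,x₂), x₁ ∈ G)` for any extra requirement `R` increasing in `x₁`. [this work] -/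
theorem triT_move32_le (τ : Set ι) {𝒰 : Set (Set ι × Set ι)}
    (h𝒰 : ∀ q q' : Set ι × Set ι, q ∈ 𝒰 → q.1 ∆ τ ⊆ q'.1 ∆ τ → q'.2 ∆ τ ⊆ q.2 ∆ τ → q' ∈ 𝒰)
    (R : Set ι → Set ι → Prop) (hR : ∀ b, IsUpperSet {a : Set ι | R a b}) {G : Set (Set ι)} (hG : IsUpperSet G) :
    triT τ (fun a b c => (inU τ 𝒰 a b ∧ R a b) ∧ c ∈ G) ≤ triT τ (fun a b _ => (inU τ 𝒰 a b ∧ R a b) ∧ a ∈ G) := by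
  have hA : ∀ b : Set ι, IsUpperSet {a : Set ι | inU τ 𝒰 a b ∧ R a b} :=
    fun b => (isUpperSet_inU_snd h𝒰 b).inter (hR b)
  have h := triT_col_le τ (fun b => {a : Set ι | inU τ 𝒰 a b ∧ R a b}) hA hG
  refine le_trans (le_of_eq (triT_congr fun a b c => ?_)) (le_trans h (le_of_eq (triT_congr fun a b c => ?_)))
  · simp only [Set.mem_setOf_eq]
  · simp only [Set.mem_setOf_eq]

/-! ## The nested faces -/

/-- **`GridTransport` for `𝒱 ⊆ 𝒲`.** [this work] -/
theorem sum_gtKernel_nonneg_of_subset (τ : Set ι) {𝒱 𝒲 : Set (Set ι)} {𝒰 : Set (Set ι × Set ι)}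
    (h𝒱 : IsUpperSet 𝒱) (h𝒲 : IsUpperSet 𝒲) (hVW : 𝒱 ⊆ 𝒲)
    (h𝒰 : ∀ q q' : Set ι × Set ι, q ∈ 𝒰 → q.1 ∆ τ ⊆ q'.1 ∆ τ → q'.2 ∆ τ ⊆ q.2 ∆ τ → q' ∈ 𝒰) :
    0 ≤ ∑ q ∈ (cfgs ι).filter (fun q => q ∈ 𝒰), gtKernel τ 𝒱 𝒲 q := by
  rw [sum_gtKernel_filter_eq]
  -- abbreviations
  set U := inU τ 𝒰 with hU
  -- `x₁ ∈ 𝒱𝒲 ⟺ x₁ ∈ 𝒱`, `x₂ ∈ 𝒱𝒲 ⟺ x₂ ∈ 𝒱`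
  have e1 : triT τ (fun a b _ => U a b ∧ a ∈ 𝒱 ∩ 𝒲) = triT τ (fun a b _ => U a b ∧ a ∈ 𝒱) :=
    triT_congr fun a b c => by
      simp only [Set.mem_inter_iff]; exact ⟨fun h => ⟨h.1, h.2.1⟩, fun h => ⟨h.1, h.2, hVW h.2⟩⟩
  have e2 : triT τ (fun a b _ => U a b ∧ b ∈ 𝒱 ∩ 𝒲) = triT τ (fun a b _ => U a b ∧ b ∈ 𝒱) :=
    triT_congr fun a b c => by
      simp only [Set.mem_inter_iff]; exact ⟨fun h => ⟨h.1, h.2.1⟩, fun h => ⟨h.1, h.2, hVW h.2⟩⟩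
  -- splittings by `x₃ ∈ 𝒲`
  have s1 := triT_and_add_triT_and_not τ (fun a b _ => U a b ∧ a ∈ 𝒱) (fun _ _ c => c ∈ 𝒲)
  have s2 := triT_and_add_triT_and_not τ (fun a b _ => U a b ∧ b ∈ 𝒱) (fun _ _ c => c ∈ 𝒲)
  -- the two Kleitman moves
  have k1 : triT τ (fun a b _ => U a b ∧ (a ∈ 𝒲 ∧ b ∈ 𝒱)) ≤ triT τ (fun a b _ => U a b ∧ a ∈ 𝒱) := by
    have h := triT_move23_le τ h𝒰 (fun a _ => a ∈ 𝒲) (fun _ => h𝒲) h𝒱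
    refine le_trans (le_of_eq (triT_congr fun a b c => ?_)) (le_trans h (triT_mono τ fun a b c h => ?_))
    · simp only [hU]; tauto
    · exact ⟨h.1.1, h.2⟩
  have k2 : triT τ (fun a b c => (U a b ∧ b ∈ 𝒱) ∧ ¬ c ∈ 𝒲) ≤ triT τ (fun a b c => (U a b ∧ a ∈ 𝒱) ∧ ¬ c ∈ 𝒲) := by
    have hR : ∀ c : Set ι, IsUpperSet {a : Set ι | c ∉ 𝒲} := fun c a a' _ ha => ha
    have h := triT_move23_le τ h𝒰 (fun _ c => c ∉ 𝒲) hR h𝒱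
    refine le_trans (le_of_eq (triT_congr fun a b c => ?_)) (le_trans h (le_of_eq (triT_congr fun a b c => ?_)))
    · simp only [hU]; tauto
    · simp only [hU]; tauto
  -- identify the pieces of `s1`, `s2` with the five counts
  have t1 : triT τ (fun a b c => (U a b ∧ a ∈ 𝒱) ∧ c ∈ 𝒲) = triT τ (fun a b c => U a b ∧ (a ∈ 𝒱 ∧ c ∈ 𝒲)) :=
    triT_congr fun a b c => by tauto
  have t2 : triT τ (fun a b c => (U a b ∧ b ∈ 𝒱) ∧ c ∈ 𝒲) = triT τ (fun a b c => U a b ∧ (b ∈ 𝒱 ∧ c ∈ 𝒲)) :=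
    triT_congr fun a b c => by tauto
  rw [e1, e2]
  rw [t1] at s1; rw [t2] at s2
  have i1 := k1; have i2 := k2
  zify at s1 s2 i1 i2
  linarith

/-- **`GridTransport` for `𝒲 ⊆ 𝒱`.** [this work] -/
theorem sum_gtKernel_nonneg_of_supset (τ : Set ι) {𝒱 𝒲 : Set (Set ι)} {𝒰 : Set (Set ι × Set ι)}
    (h𝒱 : IsUpperSet 𝒱) (h𝒲 : IsUpperSet 𝒲) (hWV : 𝒲 ⊆ 𝒱)
    (h𝒰 : ∀ q q' : Set ι × Set ι, q ∈ 𝒰 → q.1 ∆ τ ⊆ q'.1 ∆ τ → q'.2 ∆ τ ⊆ q.2 ∆ τ → q' ∈ 𝒰) :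
    0 ≤ ∑ q ∈ (cfgs ι).filter (fun q => q ∈ 𝒰), gtKernel τ 𝒱 𝒲 q := by
  rw [sum_gtKernel_filter_eq]
  set U := inU τ 𝒰 with hU
  have e1 : triT τ (fun a b _ => U a b ∧ a ∈ 𝒱 ∩ 𝒲) = triT τ (fun a b _ => U a b ∧ a ∈ 𝒲) :=
    triT_congr fun a b c => by
      simp only [Set.mem_inter_iff]; exact ⟨fun h => ⟨h.1, h.2.2⟩, fun h => ⟨h.1, hWV h.2, h.2⟩⟩
  have e2 : triT τ (fun a b _ => U a b ∧ b ∈ 𝒱 ∩ 𝒲) = triT τ (fun a b _ => U a b ∧ b ∈ 𝒲) :=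
    triT_congr fun a b c => by
      simp only [Set.mem_inter_iff]; exact ⟨fun h => ⟨h.1, h.2.2⟩, fun h => ⟨h.1, hWV h.2, h.2⟩⟩
  -- splittings
  have s1 := triT_and_add_triT_and_not τ (fun a b _ => U a b ∧ a ∈ 𝒲) (fun _ b _ => b ∈ 𝒱)
  have s2 := triT_and_add_triT_and_not τ (fun a b c => U a b ∧ (b ∈ 𝒱 ∧ c ∈ 𝒲)) (fun a _ _ => a ∈ 𝒱)
  have s3 := triT_and_add_triT_and_not τ (fun a b c => U a b ∧ (a ∈ 𝒱 ∧ c ∈ 𝒲)) (fun _ b _ => b ∈ 𝒱)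
  -- Kleitman moves: (x₃ fixed) `x₂ ∈ 𝒲 ↦ x₁ ∈ 𝒲`; (x₂ fixed) `x₃ ∈ 𝒲 ↦ x₁ ∈ 𝒲` under `x₁ ∈ 𝒱, x₂ ∉ 𝒱`
  have k1 : triT τ (fun a b _ => U a b ∧ b ∈ 𝒲) ≤ triT τ (fun a b _ => U a b ∧ a ∈ 𝒲) := by
    have hR : ∀ c : Set ι, IsUpperSet {a : Set ι | True} := fun _ _ _ _ _ => trivial
    have h := triT_move23_le τ h𝒰 (fun _ _ => True) hR h𝒲
    refine le_trans (le_of_eq (triT_congr fun a b c => ?_)) (le_trans h (le_of_eq (triT_congr fun a b c => ?_)))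
    · simp only [hU]; tauto
    · simp only [hU]; tauto
  have k2 : triT τ (fun a b c => ((U a b ∧ (a ∈ 𝒱 ∧ b ∉ 𝒱)) ∧ c ∈ 𝒲))
      ≤ triT τ (fun a b _ => ((U a b ∧ (a ∈ 𝒱 ∧ b ∉ 𝒱)) ∧ a ∈ 𝒲)) := by
    have hR : ∀ b : Set ι, IsUpperSet {a : Set ι | a ∈ 𝒱 ∧ b ∉ 𝒱} := fun b a a' hle ha => ⟨h𝒱 hle ha.1, ha.2⟩
    exact triT_move32_le τ h𝒰 (fun a b => a ∈ 𝒱 ∧ b ∉ 𝒱) hR h𝒲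
  -- relate k2's two counts to pieces of s3 and s1
  have t2a : triT τ (fun a b c => ((U a b ∧ (a ∈ 𝒱 ∧ b ∉ 𝒱)) ∧ c ∈ 𝒲))
      = triT τ (fun a b c => (U a b ∧ (a ∈ 𝒱 ∧ c ∈ 𝒲)) ∧ ¬ b ∈ 𝒱) := triT_congr fun a b c => by tauto
  have t2b : triT τ (fun a b _ => ((U a b ∧ (a ∈ 𝒱 ∧ b ∉ 𝒱)) ∧ a ∈ 𝒲))
      = triT τ (fun a b _ => (U a b ∧ a ∈ 𝒲) ∧ ¬ b ∈ 𝒱) := triT_congr fun a b c => by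
        constructor
        · intro h; exact ⟨⟨h.1.1, h.2⟩, h.1.2.2⟩
        · intro h; exact ⟨⟨h.1.1, hWV h.1.2, h.2⟩, h.1.2⟩
  -- the common piece of s2 and s3
  have t23 : triT τ (fun a b c => (U a b ∧ (b ∈ 𝒱 ∧ c ∈ 𝒲)) ∧ a ∈ 𝒱)
      = triT τ (fun a b c => (U a b ∧ (a ∈ 𝒱 ∧ c ∈ 𝒲)) ∧ b ∈ 𝒱) := triT_congr fun a b c => by tauto
  -- the N2 count is the first piece of s1
  have t1 : triT τ (fun a b _ => (U a b ∧ a ∈ 𝒲) ∧ b ∈ 𝒱) = triT τ (fun a b _ => U a b ∧ (a ∈ 𝒲 ∧ b ∈ 𝒱)) :=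
    triT_congr fun a b c => by tauto
  rw [e1, e2]
  rw [t2a, t2b] at k2
  rw [t1] at s1
  rw [t23] at s2
  have i1 := k1; have i2 := k2
  have nn : 0 ≤ triT τ (fun a b c => (U a b ∧ (b ∈ 𝒱 ∧ c ∈ 𝒲)) ∧ ¬ a ∈ 𝒱) := Nat.zero_le _
  zify at s1 s2 s3 i1 i2 nn
  linarith

/-- **`GridTransport` holds for nested pairs.** [this work] -/
theorem sum_gtKernel_nonneg_of_nested (τ : Set ι) {𝒱 𝒲 : Set (Set ι)} {𝒰 : Set (Set ι × Set ι)}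
    (h𝒱 : IsUpperSet 𝒱) (h𝒲 : IsUpperSet 𝒲) (h : 𝒱 ⊆ 𝒲 ∨ 𝒲 ⊆ 𝒱)
    (h𝒰 : ∀ q q' : Set ι × Set ι, q ∈ 𝒰 → q.1 ∆ τ ⊆ q'.1 ∆ τ → q'.2 ∆ τ ⊆ q.2 ∆ τ → q' ∈ 𝒰) :
    0 ≤ ∑ q ∈ (cfgs ι).filter (fun q => q ∈ 𝒰), gtKernel τ 𝒱 𝒲 q :=
  h.elim (fun h => sum_gtKernel_nonneg_of_subset τ h𝒱 h𝒲 h h𝒰) (fun h => sum_gtKernel_nonneg_of_supset τ h𝒱 h𝒲 h h𝒰)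

end Summit.CriticalPhenomena.PercolationContinuityZ3.Theorems.ThreePartition

end
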